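import Literature.AnabelianGeometry.SemiGraphs.ArithCor39cTransport
import Literature.AnabelianGeometry.SemiGraphs.TemperedCompatOpenShadowAt
import HarnessLib

/-!
# [SemiAnbd] Thm 5.4 (iii) ↔ Cor 3.9 junction, REVERSE direction: the chart-level shadows of an induced
# homomorphism yield the umbrella's kernel-level ι-data `hιgeomV` / `hιgeomE` / `hιgeomC` (proof-only)

Mochizuki, *Semi-graphs of anabelioids*, Publ. RIMS **42** (2006), §5, Theorem 5.4 (iii), manuscript p. 66
("Applying `B^temp(−)` … the proofs are entirely parallel to those of Theorem 3.7, Corollary 3.9"); §5 p. 65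
("`Π^temp_{𝔾,v} := Π^temp_{𝔊,v} ∩ Π^temp_𝔾`") [cite: MochizukiSemiAnbd2006, Thm 5.4 (iii), p. 66].

PROOF-ONLY (cell abc-iut, layer L3; continuation of L3-lead ruling α22-4 (i), seat abc-iut-w4-d083; no
definition).  The Thm 5.4 (iii) umbrella v3c (abc-iut-w5-d141) carries, for its abstract datum
`ι g : Ker aug_𝔊 → Π^temp_ℍ` ("`B^temp(g)` on the geometric tempered groups"), three kernel-level shadows:
`hιgeomV` (every `Π^temp_{𝔊,v} ∩ Ker` maps onto an open subgroup of the geometric part of a conjugate of some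
`Π^temp_{ℍ,w}`), `hιgeomE` (branches likewise) and — for the clause-1 compatibility binder `h1c` via
`Thm54iii.h1c_of_iota` (abc-iut-w4-d083) — `hιgeomC` (distinct geometric verticial subgroups meeting
non-trivially map onto open subgroups of DISTINCT geometric verticial subgroups).  This file is the mirror of
`ArithCor39cTransport.lean`: for ANY homomorphism `ιg : Ker aug_𝔊 → Π^temp_ℍ` agreeing through the producer's
embeddings `ι_𝔾`, `ι_ℍ` with a chart-level `φ̂ : π₁^temp(𝔾) → π₁^temp(ℍ)` (`ιg (ι_𝔾 y) = ι_ℍ (φ̂ y)`), the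
CHART-level shadows of `φ̂` (`hV`, `hE`, and the compatibility-with-openness shadow of
`TemperedCompatOpenShadowAt.lean`) give exactly those three kernel-level data over abc-iut-w4-d053's produced
decomposition data `decompositionDataOfChart R ι` (`MapsOntoOpenSubgroupOf.subgroupOf_map` = "maps onto an
open subgroup of" ASCENDS along the embeddings; `iotaShadowV/E/C_of_shadow…`); and
`iotaShadows_of_compatVAt` packages them for `φ̂` compatible with a LOCALLY OPEN `F : 𝔾 → ℍ` (Cor. 3.9 (a),
compatible reading, at the pair; modulo Thm 3.7 (iii) at `𝔾` and `ℍ`).  With this and `ArithCor39cTransport`,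
the producer's remaining debts on the Thm 5.4 (iii) compat chain are the DEFINITION of `ι g` through the
charts and the arithmetic-twist / injectivity / `B^temp` identities `hιG hιH hιinj hιbtemp` (+ `hadj`).
Nothing asserted for real tempered data; nothing here bears on [IUTchIII] Cor. 3.12; typed ≠ proved.
-/

namespace Literature.AnabelianGeometry.SemiGraphs

open _root_.Topology

universe u uG uH uP

/-! ### "Maps onto an open subgroup of" ascends along embeddings -/

section Bookkeeping

variable {P : Type*} [Group P] {Q : Type*} [Group Q] [TopologicalSpace Q]
variable {Gtp : Type uG} [Group Gtp] {Htp : Type uH} [Group Htp] [TopologicalSpace Htp]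

/-- **"Maps onto an open subgroup of" ASCENDS along embeddings**: for `ι_P : P → G` with image inside a subgroup
`N`, an injective embedding `ι_Q : Q ↪ H`, and `ιg : N → H` with `ιg ∘ ι_P = ι_Q ∘ φ`, if `φ` maps `K` onto an open
subgroup of `K₂` then `ιg` maps `ι_P(K)` (viewed in `N`) onto an open subgroup of `ι_Q(K₂)` (the step "apply
`B^temp(−)` on the geometric tempered groups" of Thm 5.4 (iii)). [cite: MochizukiSemiAnbd2006, Thm 5.4 (iii), p. 66] -/
theorem MapsOntoOpenSubgroupOf.subgroupOf_map (ιP : P →* Gtp) (ιQ : Q →* Htp) (hιQ : Function.Injective ιQ)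
    (hemb : IsEmbedding ιQ) (N : Subgroup Gtp) (hN : ιP.range ≤ N) (ιg : N →* Htp) {φ : P →* Q}
    (hιg : ∀ (x : N) (y : P), (x : Gtp) = ιP y → ιg x = ιQ (φ y))
    {K : Subgroup P} {K₂ : Subgroup Q} (h : MapsOntoOpenSubgroupOf φ K K₂) :
    MapsOntoOpenSubgroupOf ιg ((K.map ιP).subgroupOf N) (K₂.map ιQ) := by
  have himg : ((K.map ιP).subgroupOf N).map ιg = (K.map φ).map ιQ := by
    ext z
    constructor
    · rintro ⟨x, hx, rfl⟩
      obtain ⟨k, hk, hkx⟩ := Subgroup.mem_subgroupOf.mp hx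
      exact ⟨φ k, ⟨k, hk, rfl⟩, (hιg x k hkx.symm).symm⟩
    · rintro ⟨_, ⟨k, hk, rfl⟩, rfl⟩
      refine ⟨⟨ιP k, hN ⟨k, rfl⟩⟩, Subgroup.mem_subgroupOf.mpr ⟨k, hk, rfl⟩, hιg _ k rfl⟩
  refine ⟨?_, ?_⟩
  · rw [himg]
    exact Subgroup.map_mono h.1
  · obtain ⟨V, hV, hVeq⟩ := isOpen_induced_iff.mp h.2
    obtain ⟨W, hW, rfl⟩ := hemb.isInducing.isOpen_iff.mp hV
    refine isOpen_induced_iff.mpr ⟨W, hW, ?_⟩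
    rw [himg]
    ext ⟨z, hz⟩
    obtain ⟨q, hq, rfl⟩ := hz
    have hVq : q ∈ ιQ ⁻¹' W ↔ q ∈ (K.map φ : Set Q) := by
      have := congrArg (fun s : Set K₂ => (⟨q, hq⟩ : K₂) ∈ s) hVeq
      simpa using this
    simp only [Set.mem_preimage, SetLike.mem_coe]
    rw [Set.mem_preimage] at hVq
    rw [hVq]
    constructor
    · exact fun hq' => ⟨q, hq', rfl⟩
    · rintro ⟨q', hq', hqq⟩
      rwa [← hιQ hqq]

end Bookkeeping

namespace ProfiniteSemiGraph

variable {𝒢 ℋ : ProfiniteSemiGraph.{u}} {c𝒢 : TemperedPiChart 𝒢} {cℋ : TemperedPiChart ℋ}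
variable {Gtp : Type uG} [Group Gtp]
variable {Htp : Type uH} [Group Htp] [TopologicalSpace Htp]
variable {PA : Type uP} [Group PA] [TopologicalSpace PA]

omit [TopologicalSpace PA] in
/-- **`hιgeomV` from the chart-level `hV`**: if `φ̂` maps every verticial subgroup of `π₁^temp(𝔾)` onto an open
subgroup of a verticial subgroup of `π₁^temp(ℍ)`, then ANY `ιg : Ker aug_𝔊 → Π^temp_ℍ` agreeing with `φ̂` through
the embeddings maps `Π^temp_{𝔊,v} ∩ Ker` onto an open subgroup of the geometric part of a conjugate of some
`Π^temp_{ℍ,w}` — the umbrella's binder `hιgeomV`, verbatim shape. [cite: MochizukiSemiAnbd2006, Thm 5.4 (iii), p. 66] -/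
theorem iotaShadowV_of_shadowV (h𝒢 : 𝒢.Thm37Hypotheses) (hℋ : ℋ.Thm37Hypotheses)
    (R : ChartRepresentatives c𝒢) (R' : ChartRepresentatives cℋ) (ι𝒢 : c𝒢.G →* Gtp) (ιℋ : cℋ.G →* Htp)
    (hι𝒢 : Function.Injective ι𝒢) (hιℋ : Function.Injective ιℋ) (hιℋe : IsEmbedding ιℋ)
    (augG : Gtp →* PA) (augH' : Htp →* PA) (hex𝒢 : ι𝒢.range = augG.ker) (hexℋ : ιℋ.range = augH'.ker)
    (ιg : augG.ker →* Htp) {φ : c𝒢.G →* cℋ.G}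
    (hιg : ∀ (x : augG.ker) (y : c𝒢.G), (x : Gtp) = ι𝒢 y → ιg x = ιℋ (φ y))
    (hV : ∀ (v : 𝒢.graph.Vertex) (K : Subgroup c𝒢.G), K ∈ verticialSubgroups c𝒢 v →
      ∃ (w : ℋ.graph.Vertex) (K₂ : Subgroup cℋ.G), K₂ ∈ verticialSubgroups cℋ w ∧
        MapsOntoOpenSubgroupOf φ K K₂) :
    ∃ fv : 𝒢.graph.Vertex → ℋ.graph.Vertex, ∀ v : 𝒢.graph.Vertex, ∃ x : Htp,
      MapsOntoOpenSubgroupOf ιg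
        (((decompositionDataOfChart R ι𝒢).vertGp v ⊓ augG.ker).subgroupOf augG.ker)
        (conjSubgroup x ((decompositionDataOfChart R' ιℋ).vertGp (fv v)) ⊓ augH'.ker) := by
  haveI : augH'.ker.Normal := MonoidHom.normal_ker augH'
  choose fv K₂ hK₂ hm using fun v => hV v (R.Hv v) (R.Hv_mem v)
  refine ⟨fv, fun v => ?_⟩
  obtain ⟨k, hk⟩ := exists_conj_of_mem_verticialSubgroups cℋ (R'.Hv_mem (fv v)) (hK₂ v)
  refine ⟨ιℋ k, ?_⟩
  have h := MapsOntoOpenSubgroupOf.subgroupOf_map ι𝒢 ιℋ hιℋ hιℋe augG.ker hex𝒢.le ιg hιg (hm v)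
  rw [hk, map_conjSubgroup_eq, ← vertGp_inf_ker_eq_map hℋ R' ιℋ hιℋ augH' hexℋ (fv v),
    conjSubgroup_inf_of_normal] at h
  rwa [vertGp_inf_ker_eq_map h𝒢 R ι𝒢 hι𝒢 augG hex𝒢 v]

omit [TopologicalSpace PA] in
/-- **`hιgeomE` from the chart-level `hE`** (primed shape of `hE`: target nontriviality not required): `ιg` maps
every `Π^temp_{𝔊,b} ∩ Ker` onto an open subgroup of the geometric part of a conjugate of some `Π^temp_{ℍ,b'}` —
modulo Thm 3.7 (iii) at `𝔾` and at `ℍ` (the branch dictionary). [cite: MochizukiSemiAnbd2006, Thm 5.4 (iii), p. 66] -/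
theorem iotaShadowE_of_shadowE (h𝒢iii : CompactInVerticialAt 𝒢) (hℋiii : CompactInVerticialAt ℋ)
    (h𝒢 : Cor39Hypotheses 𝒢) (hℋ : Cor39Hypotheses ℋ)
    (R : ChartRepresentatives c𝒢) (R' : ChartRepresentatives cℋ) (ι𝒢 : c𝒢.G →* Gtp) (ιℋ : cℋ.G →* Htp)
    (hι𝒢 : Function.Injective ι𝒢) (hιℋ : Function.Injective ιℋ) (hιℋe : IsEmbedding ιℋ)
    (augG : Gtp →* PA) (augH' : Htp →* PA) (hex𝒢 : ι𝒢.range = augG.ker) (hexℋ : ιℋ.range = augH'.ker)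
    (ιg : augG.ker →* Htp) {φ : c𝒢.G →* cℋ.G}
    (hιg : ∀ (x : augG.ker) (y : c𝒢.G), (x : Gtp) = ι𝒢 y → ιg x = ιℋ (φ y))
    (hE : ∀ (e : 𝒢.graph.Edge) (L : Subgroup c𝒢.G), 𝒢.graph.IsClosedEdge e →
      L ∈ edgeLikeSubgroups c𝒢 e → L ≠ ⊥ →
      ∃ (e' : ℋ.graph.Edge) (L₂ : Subgroup cℋ.G), ℋ.graph.IsClosedEdge e' ∧
        L₂ ∈ edgeLikeSubgroups cℋ e' ∧ MapsOntoOpenSubgroupOf φ L L₂) :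
    ∃ fb : 𝒢.graph.Branch → ℋ.graph.Branch, ∀ b : 𝒢.graph.Branch, ∃ x : Htp,
      MapsOntoOpenSubgroupOf ιg
        (((decompositionDataOfChart R ι𝒢).brGp b ⊓ augG.ker).subgroupOf augG.ker)
        (conjSubgroup x ((decompositionDataOfChart R' ιℋ).brGp (fb b)) ⊓ augH'.ker) := by
  haveI : augH'.ker.Normal := MonoidHom.normal_ker augH'
  -- the edge-like representative of `b` is non-trivial (edge groups are infinite, Thm 3.7 (i))
  have hne : ∀ b : 𝒢.graph.Branch, R.Hb b ≠ ⊥ := by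
    intro b h0
    have hmem := R.Hb_mem b
    rw [h0] at hmem
    haveI := infinite_of_mem_edgeLikeSubgroups verticialInjective_holds h𝒢.thm37Hypotheses c𝒢 hmem
    exact not_finite (⊥ : Subgroup c𝒢.G)
  have hex : ∀ b : 𝒢.graph.Branch, ∃ (b' : ℋ.graph.Branch) (L₂ : Subgroup cℋ.G),
      L₂ ∈ edgeLikeSubgroups cℋ (ℋ.graph.edgeOf b') ∧ MapsOntoOpenSubgroupOf φ (R.Hb b) L₂ := by
    intro b
    obtain ⟨e', L₂, -, hL₂, hm⟩ := hE (𝒢.graph.edgeOf b) (R.Hb b)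
      (isClosedEdge_of_isGraph h𝒢.isGraph _) (R.Hb_mem b) (hne b)
    obtain ⟨b', -, -, hb'e, -, -⟩ := ℋ.graph.two_branches e'
    exact ⟨b', L₂, hb'e ▸ hL₂, hm⟩
  choose fb L₂ hL₂ hm using hex
  refine ⟨fb, fun b => ?_⟩
  obtain ⟨k, hk⟩ := exists_conj_of_mem_edgeLikeSubgroups cℋ (R'.Hb_mem (fb b)) (hL₂ b)
  refine ⟨ιℋ k, ?_⟩
  have h := MapsOntoOpenSubgroupOf.subgroupOf_map ι𝒢 ιℋ hιℋ hιℋe augG.ker hex𝒢.le ιg hιg (hm b)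
  rw [hk, map_conjSubgroup_eq,
    ← brGp_inf_ker_eq_map hℋiii hℋ.thm37Hypotheses hℋ.isGraph R' ιℋ hιℋ augH' hexℋ (fb b),
    conjSubgroup_inf_of_normal] at h
  rwa [brGp_inf_ker_eq_map h𝒢iii h𝒢.thm37Hypotheses h𝒢.isGraph R ι𝒢 hι𝒢 augG hex𝒢 b]

/-- **`hιgeomC` from the chart-level compatibility-with-openness shadow** (the datum of
`Thm54iii.h1c_of_iota`, verbatim shape; the `ArithChartAction` of `𝔾` absorbs the arbitrary conjugators
`γ ∈ Π^temp_𝔊`). [cite: MochizukiSemiAnbd2006, Thm 5.4 (iii), p. 66] -/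
theorem iotaShadowC_of_shadowC (h𝒢 : 𝒢.Thm37Hypotheses) (hℋ : ℋ.Thm37Hypotheses)
    (R : ChartRepresentatives c𝒢) (R' : ChartRepresentatives cℋ) (ι𝒢 : c𝒢.G →* Gtp) (ιℋ : cℋ.G →* Htp)
    (hι𝒢 : Function.Injective ι𝒢) (hιℋ : Function.Injective ιℋ) (hιℋe : IsEmbedding ιℋ)
    (augG : Gtp →* PA) (augH' : Htp →* PA) (hex𝒢 : ι𝒢.range = augG.ker) (hexℋ : ιℋ.range = augH'.ker)
    {actV : PA → 𝒢.graph.Vertex → 𝒢.graph.Vertex} {actE : PA → 𝒢.graph.Edge → 𝒢.graph.Edge}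
    {actB : PA → 𝒢.graph.Branch → 𝒢.graph.Branch} (A𝒢 : ArithChartAction c𝒢 ι𝒢 augG actV actE actB)
    (ιg : augG.ker →* Htp) {φ : c𝒢.G →* cℋ.G}
    (hιg : ∀ (x : augG.ker) (y : c𝒢.G), (x : Gtp) = ι𝒢 y → ιg x = ιℋ (φ y))
    (hC : ∀ (v₁ v₂ : 𝒢.graph.Vertex) (K₁ H₁ : Subgroup c𝒢.G), K₁ ∈ verticialSubgroups c𝒢 v₁ →
      H₁ ∈ verticialSubgroups c𝒢 v₂ → K₁ ≠ H₁ → K₁ ⊓ H₁ ≠ ⊥ →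
      ∃ (w₁ w₂ : ℋ.graph.Vertex) (K₂ H₂ : Subgroup cℋ.G), K₂ ∈ verticialSubgroups cℋ w₁ ∧
        H₂ ∈ verticialSubgroups cℋ w₂ ∧ K₂ ≠ H₂ ∧ MapsOntoOpenSubgroupOf φ K₁ K₂ ∧
        MapsOntoOpenSubgroupOf φ H₁ H₂) :
    ∀ (v₁ v₂ : 𝒢.graph.Vertex) (γ₁ γ₂ : Gtp),
      conjSubgroup γ₁ ((decompositionDataOfChart R ι𝒢).vertGp v₁) ⊓ augG.ker ≠
          conjSubgroup γ₂ ((decompositionDataOfChart R ι𝒢).vertGp v₂) ⊓ augG.ker →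
      conjSubgroup γ₁ ((decompositionDataOfChart R ι𝒢).vertGp v₁) ⊓
          conjSubgroup γ₂ ((decompositionDataOfChart R ι𝒢).vertGp v₂) ⊓ augG.ker ≠ ⊥ →
        ∃ (w₁ w₂ : ℋ.graph.Vertex) (x₁ x₂ : Htp),
          conjSubgroup x₁ ((decompositionDataOfChart R' ιℋ).vertGp w₁) ⊓ augH'.ker ≠
              conjSubgroup x₂ ((decompositionDataOfChart R' ιℋ).vertGp w₂) ⊓ augH'.ker ∧
          MapsOntoOpenSubgroupOf ιg
            ((conjSubgroup γ₁ ((decompositionDataOfChart R ι𝒢).vertGp v₁) ⊓ augG.ker).subgroupOf augG.ker)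
            (conjSubgroup x₁ ((decompositionDataOfChart R' ιℋ).vertGp w₁) ⊓ augH'.ker) ∧
          MapsOntoOpenSubgroupOf ιg
            ((conjSubgroup γ₂ ((decompositionDataOfChart R ι𝒢).vertGp v₂) ⊓ augG.ker).subgroupOf augG.ker)
            (conjSubgroup x₂ ((decompositionDataOfChart R' ιℋ).vertGp w₂) ⊓ augH'.ker) := by
  haveI : augH'.ker.Normal := MonoidHom.normal_ker augH'
  intro v₁ v₂ γ₁ γ₂ hne hnt
  -- the two geometric parts are `ι𝒢` of verticial subgroups at the translated vertices
  obtain ⟨K₁, hK₁, hK₁eq⟩ := conj_vertGp_inf_ker_eq_map h𝒢 R ι𝒢 hι𝒢 augG hex𝒢 A𝒢 γ₁ v₁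
  obtain ⟨H₁, hH₁, hH₁eq⟩ := conj_vertGp_inf_ker_eq_map h𝒢 R ι𝒢 hι𝒢 augG hex𝒢 A𝒢 γ₂ v₂
  have hne' : K₁ ≠ H₁ := fun h => hne (by rw [hK₁eq, hH₁eq, h])
  have hnt' : K₁ ⊓ H₁ ≠ ⊥ := by
    intro h
    apply hnt
    rw [show ∀ S T N : Subgroup Gtp, S ⊓ T ⊓ N = (S ⊓ N) ⊓ (T ⊓ N) from fun S T N => by
      rw [inf_inf_inf_comm, inf_idem], hK₁eq, hH₁eq, ← Subgroup.map_inf _ _ ι𝒢 hι𝒢, h, Subgroup.map_bot]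
  obtain ⟨w₁, w₂, K₂, H₂, hK₂, hH₂, hne₂, hm₁, hm₂⟩ := hC _ _ K₁ H₁ hK₁ hH₁ hne' hnt'
  obtain ⟨k₁, hk₁⟩ := exists_conj_of_mem_verticialSubgroups cℋ (R'.Hv_mem w₁) hK₂
  obtain ⟨k₂, hk₂⟩ := exists_conj_of_mem_verticialSubgroups cℋ (R'.Hv_mem w₂) hH₂
  have hT : ∀ (w : ℋ.graph.Vertex) (k : cℋ.G),
      ((R'.Hv w).map (MulAut.conj k).toMonoidHom).map ιℋ =
        conjSubgroup (ιℋ k) ((decompositionDataOfChart R' ιℋ).vertGp w) ⊓ augH'.ker := by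
    intro w k
    rw [map_conjSubgroup_eq, ← vertGp_inf_ker_eq_map hℋ R' ιℋ hιℋ augH' hexℋ w,
      conjSubgroup_inf_of_normal]
  have h₁ := MapsOntoOpenSubgroupOf.subgroupOf_map ι𝒢 ιℋ hιℋ hιℋe augG.ker hex𝒢.le ιg hιg hm₁
  have h₂ := MapsOntoOpenSubgroupOf.subgroupOf_map ι𝒢 ιℋ hιℋ hιℋe augG.ker hex𝒢.le ιg hιg hm₂
  rw [← hK₁eq, hk₁, hT] at h₁
  rw [← hH₁eq, hk₂, hT] at h₂
  refine ⟨w₁, w₂, ιℋ k₁, ιℋ k₂, fun hEq => hne₂ ?_, h₁, h₂⟩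
  apply Subgroup.map_injective hιℋ
  rw [hk₁, hk₂, hT, hT, hEq]

/-- **The three ι-data for a homomorphism induced by a LOCALLY OPEN morphism** (Cor. 3.9 (a), compatible
reading, at the pair — `openShadows_of_compatVAt` / `compatOpenShadow_of_compatVAt_of_compactInVerticialAt` —
ascended to the kernels): for `F : 𝔾 → ℍ` locally open, `φ̂` compatible with `F` on verticial and edge
homomorphisms, and any `ιg` agreeing with `φ̂` through the embeddings, the umbrella's `hιgeomV`, `hιgeomE` and
`hιgeomC` hold for `ιg`, modulo Thm 3.7 (iii) AT `𝔾` AND AT `ℍ`. [cite: MochizukiSemiAnbd2006, Thm 5.4 (iii), p. 66] -/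
theorem iotaShadows_of_compatVAt (h𝒢iii : CompactInVerticialAt 𝒢) (hℋiii : CompactInVerticialAt ℋ)
    (h𝒢 : Cor39Hypotheses 𝒢) (hℋ : Cor39Hypotheses ℋ)
    (R : ChartRepresentatives c𝒢) (R' : ChartRepresentatives cℋ) (ι𝒢 : c𝒢.G →* Gtp) (ιℋ : cℋ.G →* Htp)
    (hι𝒢 : Function.Injective ι𝒢) (hιℋ : Function.Injective ιℋ) (hιℋe : IsEmbedding ιℋ)
    (augG : Gtp →* PA) (augH' : Htp →* PA) (hex𝒢 : ι𝒢.range = augG.ker) (hexℋ : ιℋ.range = augH'.ker)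
    {actV : PA → 𝒢.graph.Vertex → 𝒢.graph.Vertex} {actE : PA → 𝒢.graph.Edge → 𝒢.graph.Edge}
    {actB : PA → 𝒢.graph.Branch → 𝒢.graph.Branch} (A𝒢 : ArithChartAction c𝒢 ι𝒢 augG actV actE actB)
    (F : Hom 𝒢 ℋ) (φ : c𝒢.G →ₜ* cℋ.G) (hF : F.IsLocallyOpen) (hV : F.CompatV c𝒢 cℋ φ)
    (hE : F.CompatE c𝒢 cℋ φ) (ιg : augG.ker →* Htp)
    (hιg : ∀ (x : augG.ker) (y : c𝒢.G), (x : Gtp) = ι𝒢 y → ιg x = ιℋ (φ y)) :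
    (∃ fv : 𝒢.graph.Vertex → ℋ.graph.Vertex, ∀ v : 𝒢.graph.Vertex, ∃ x : Htp,
      MapsOntoOpenSubgroupOf ιg
        (((decompositionDataOfChart R ι𝒢).vertGp v ⊓ augG.ker).subgroupOf augG.ker)
        (conjSubgroup x ((decompositionDataOfChart R' ιℋ).vertGp (fv v)) ⊓ augH'.ker)) ∧
    (∃ fb : 𝒢.graph.Branch → ℋ.graph.Branch, ∀ b : 𝒢.graph.Branch, ∃ x : Htp,
      MapsOntoOpenSubgroupOf ιg
        (((decompositionDataOfChart R ι𝒢).brGp b ⊓ augG.ker).subgroupOf augG.ker)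
        (conjSubgroup x ((decompositionDataOfChart R' ιℋ).brGp (fb b)) ⊓ augH'.ker)) ∧
    (∀ (v₁ v₂ : 𝒢.graph.Vertex) (γ₁ γ₂ : Gtp),
      conjSubgroup γ₁ ((decompositionDataOfChart R ι𝒢).vertGp v₁) ⊓ augG.ker ≠
          conjSubgroup γ₂ ((decompositionDataOfChart R ι𝒢).vertGp v₂) ⊓ augG.ker →
      conjSubgroup γ₁ ((decompositionDataOfChart R ι𝒢).vertGp v₁) ⊓
          conjSubgroup γ₂ ((decompositionDataOfChart R ι𝒢).vertGp v₂) ⊓ augG.ker ≠ ⊥ →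
        ∃ (w₁ w₂ : ℋ.graph.Vertex) (x₁ x₂ : Htp),
          conjSubgroup x₁ ((decompositionDataOfChart R' ιℋ).vertGp w₁) ⊓ augH'.ker ≠
              conjSubgroup x₂ ((decompositionDataOfChart R' ιℋ).vertGp w₂) ⊓ augH'.ker ∧
          MapsOntoOpenSubgroupOf ιg
            ((conjSubgroup γ₁ ((decompositionDataOfChart R ι𝒢).vertGp v₁) ⊓ augG.ker).subgroupOf augG.ker)
            (conjSubgroup x₁ ((decompositionDataOfChart R' ιℋ).vertGp w₁) ⊓ augH'.ker) ∧
          MapsOntoOpenSubgroupOf ιg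
            ((conjSubgroup γ₂ ((decompositionDataOfChart R ι𝒢).vertGp v₂) ⊓ augG.ker).subgroupOf augG.ker)
            (conjSubgroup x₂ ((decompositionDataOfChart R' ιℋ).vertGp w₂) ⊓ augH'.ker)) := by
  obtain ⟨hVsh, hEsh⟩ := openShadows_of_compatVAt h𝒢iii hℋiii h𝒢 hℋ c𝒢 cℋ F φ hF hV hE
  refine ⟨iotaShadowV_of_shadowV h𝒢.thm37Hypotheses hℋ.thm37Hypotheses R R' ι𝒢 ιℋ hι𝒢 hιℋ hιℋe augG
      augH' hex𝒢 hexℋ ιg hιg hVsh,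
    iotaShadowE_of_shadowE h𝒢iii hℋiii h𝒢 hℋ R R' ι𝒢 ιℋ hι𝒢 hιℋ hιℋe augG augH' hex𝒢 hexℋ ιg hιg
      (fun e L he hL hL0 => ?_),
    iotaShadowC_of_shadowC h𝒢.thm37Hypotheses hℋ.thm37Hypotheses R R' ι𝒢 ιℋ hι𝒢 hιℋ hιℋe augG augH'
      hex𝒢 hexℋ A𝒢 ιg hιg
      (compatOpenShadow_of_compatVAt_of_compactInVerticialAt h𝒢iii hℋiii h𝒢 hℋ c𝒢 cℋ F φ hF hV hE)⟩
  obtain ⟨e', L₂, he', hL₂, -, hm⟩ := hEsh e L he hL hL0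
  exact ⟨e', L₂, he', hL₂, hm⟩

end ProfiniteSemiGraph

end Literature.AnabelianGeometry.SemiGraphs
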